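import Literature.Geometry.Kaehler.ComplexTorusHodgeGroupHodgeCircleCriteria
import Literature.Geometry.Kaehler.ComplexTorusProductHomRank
import Literature.Geometry.Kaehler.ComplexTorusHodgeGroupProduct
import Literature.Geometry.Kaehler.ComplexTorusEllipticCurveCMIsogenyClasses
import HarnessLib

/-!
# The Hodge circle under products: `Hg(X₁ × X₂)(ℝ) = h(S¹)` iff `X₁ ∼ E^{g₁}` and `X₂ ∼ E^{g₂}` for ONE
# elliptic curve `E` with complex multiplication — iff both factors have Hodge group the circle AND
# `Hom(X₁, X₂) ≠ 0`; then `Hg(X₁ × X₂) ⊊ Hg(X₁) × Hg(X₂)` is the diagonal circle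
# (Beauville 2014, §4 Prop. 5 / Lemma 1; Imai 1976, §3 Remarks; Green–Griffiths–Kerr 2012, §III.B (i))

Layer `Literature/Geometry/Kaehler`, namespace `Literature.Geometry.Kaehler.ComplexTorus`; lane `lit-hodgefound`
(Track 2 foundations library, Layer A1/A3 «Hodge groups of complex tori; CM type»), prover seat p17, generation 32,
self-proposed row g32-#1 (gen-31 FREE POINTER (α): the Hodge-circle locus on products).  Sequel BY NAME of g31-#4
(`ComplexTorusHodgeGroupHodgeCircleMaximalPicard`: for a complex torus `X` of dimension `g ≥ 1`,
`Hg(X)(ℝ) = h(S¹)` ⟺ `rk End(X) = 2g²` ⟺ `X ∼ E_τ^g` with `E_τ` CM), of `ComplexTorusProductHomRank` /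
`ComplexTorusHomRankEquality` (Beauville's Prop. 3 and Lemma 1 for a product torus `X₁ × X₂ = (E₁ × E₂)/(Φ₁ ⊕ Φ₂)(ℤ^{ι₁ ⊔ ι₂})`:
`rk End(X₁ × X₂) = 2(g₁ + g₂)²` ⟺ `rk Hom(X₁, X₂) = 2g₁g₂` ⟺ `X₁ ∼ E_τ^{g₁}`, `X₂ ∼ E_τ^{g₂}` for one CM curve `E_τ`),
of `ComplexTorusHodgeGroupProduct` (`Hg(X₁ × X₂)(ℝ) ⊆ Hg(X₁)(ℝ) × Hg(X₂)(ℝ)` block-diagonally, `hodgeGroup_prod_le`;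
`h_{X₁ × X₂}(e^{iθ}) = (h₁(e^{iθ}) 0; 0 h₂(e^{iθ}))`) and of g31-#2 (`ComplexTorusHodgeGroupHodgeCircle`: Imai's
`Hg(E_τ)(ℝ) = h(S¹)` ⟺ `E_τ` CM).  THEOREMS ONLY: no definition, no instance, no named fact, nothing conditional
(D-0026, net debt 0).

## Sources, verbatim

* A. Beauville, *Some surfaces with maximal Picard number*, J. Éc. polytech. Math. 1 (2014) 101–116 (held text
  `paper:arxiv-1310.3402`), §4 **Proposition 5** (p0006 L3–L7): «Let `C, C'` be two smooth projective curves, of genus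
  `g` and `g'` respectively. The following conditions are equivalent: (i) The surface `C × C'` is `ρ`-maximal; (ii) There
  exists an elliptic curve `E` with complex multiplication such that `JC` is isogenous to `E^g` and `JC'` to `E^{g'}`.»;
  **Lemma 1** (p0006 L18–L19): «Let `A` and `B` be two abelian varieties, of dimension `a` and `b` respectively. The
  `ℤ`-module `Hom(A,B)` has rank `≤ 2ab`; equality holds if and only if there exists an elliptic curve `E` with complex
  multiplication such that `A` is isogenous to `E^a` and `B` to `E^b`.»; §3 Prop. 3 (p0005): «(ii) `rk_ℤ End(A) = 2g²`;
  (iii) `A` is isogenous to `E^g`, where `E` is an elliptic curve with complex multiplication».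
* H. Imai, *On the Hodge groups of some abelian varieties*, Kōdai Math. Sem. Rep. 27 (1976) 367–372 (held
  `paper:doi-10-2996-kmj-1138847263`), p. 367 L9–L10: «For non-isogenous elliptic curves `Eᵢ` (`i = 1, 2, ⋯, n`),
  `Hg(E₁ × ⋯ × Eₙ) = Hg(E₁) × ⋯ × Hg(Eₙ)`»; §3 Remarks (p. 370 L23–L38): «If `E₁` and `E₂` are isogenous elliptic curves,
  the Hodge group of `E₁ × E₂` is obtained as `{(x, λxλ⁻¹)}` where `λ : E₁ → E₂` is an isogeny … `Δ_m(H)` = the diagonal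
  subgroup of `H^m`»; §2 (p. 368 L5–L7): «`Hg(E)` is a 1-dimensional torus if `E` is of CM-type».
* M. Green, P. Griffiths, M. Kerr, *Mumford–Tate Groups and Domains* (2012), §III.B (i) (p. 72): «`M_{φ₁+φ₂} ⊂ M_{φ₁} × M_{φ₂}`
  … the inclusions (i), (ii) are in general not isomorphisms»; §VII.G Prop. (VII.G.2) and table (type (ix) "`V₁ ≅ V₂`, with
  CM by same IQF `K`": `M(ℝ) = U(1)`).
* B. Moonen, *Notes on Mumford–Tate groups* (1999), (1.13) Remark: «`Hg(V) ⊆ Hg(V₁) × Hg(V₂)`. This need not be an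
  equality».
* B. Moonen, Yu. Zarhin, *Hodge classes on abelian varieties of low dimension*, Math. Ann. 315 (1999), §1, (0.2)(4).
* H. Lange, *Abelian Varieties over the Complex Numbers* (2023), §2.6.3 Exercise (2) ((i) `ρ(X) = g²` ⟺ (ii) `X ∼ E^g`,
  `E` with complex multiplication), §7.2.4 Exercise (3), §7.2.3 Prop. 7.2.6.

## What is proved ("circle(`Φ`)" = `(hodgeGroup Φ : Set _) = Set.range (hodgeCircleSL Φ)`; `gᵢ = dim Xᵢ ≥ 1`)

* §1 **`Hg(X₁ × X₂)(ℝ) = h(S¹)` ⟺ ∃ CM curve `E_τ`, `X₁ ∼ E_τ^{g₁} ∧ X₂ ∼ E_τ^{g₂}`**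
  (`coe_hodgeGroup_prodPeriod_eq_range_iff_exists_isIsogenous_ellipticPow_cm`) **⟺ `rk End(X₁ × X₂) = 2(g₁+g₂)²` ⟺
  `rk Hom(X₁, X₂) = 2g₁g₂` ⟺ `ρ(X₁ × X₂) = (g₁ + g₂)²`** (the last for ALL `g₁, g₂ ≥ 1`, the product having dimension
  `≥ 2`); ⟹ both factors have Hodge group the circle (`coe_hodgeGroup_eq_range_of_prodPeriod_left/right`).
* §2 **`Hg(X₁ × X₂)(ℝ) = h(S¹)` ⟺ circle(`X₁`) ∧ circle(`X₂`) ∧ `Hom(X₁, X₂) ≠ 0`**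
  (`coe_hodgeGroup_prodPeriod_eq_range_iff_homRat_ne_bot`: two tori isogenous to powers of CM curves `E₁`, `E₂` with a
  non-zero homomorphism have `E₁ ∼ E₂`) **⟺ circle(`X₁`) ∧ circle(`X₂`) ∧ `X₁^{g₂} ∼ X₂^{g₁}`**; for `g₁ = g₂`:
  **⟺ circle(`X₁`) ∧ `X₁ ∼ X₂`**; `Hg(X × X)(ℝ) = h(S¹)` ⟺ `Hg(X)(ℝ) = h(S¹)`; symmetry in the factors.
* §3 **ON THE LOCUS `Hg(X₁ × X₂)(ℝ)` IS THE DIAGONAL CIRCLE `{(h₁(e^{iθ}) 0; 0 h₂(e^{iθ}))}`, STRICTLY SMALLER THAN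
  `Hg(X₁)(ℝ) × Hg(X₂)(ℝ) = h₁(S¹) × h₂(S¹)`** (Imai's `Δ`, GGK's "in general not isomorphisms": the element
  `(1 0; 0 h₂(e^{iπ})) = (1 0; 0 -1)` of the product is not on the diagonal) — `hodgeCircle_eq_one_iff`,
  `coe_hodgeGroup_prodPeriod_eq_range_blockDiag`, **`hodgeGroup_prodPeriod_lt_of_coe_eq_range`**,
  `hodgeGroup_prodPeriod_ne_map_blockDiag_prod`; consequences on the locus: `X₁ × X₂` is an abelian variety,
  `H^{2p}_Hodge(X₁ × X₂) = D^p(X₁ × X₂)` of dimension `C(g₁+g₂, p)²`, `Lf(X₁ × X₂) = Hg(X₁ × X₂)` for every polarisation.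
* §4 **ELLIPTIC CURVES**: `Hg(E_{τ₁} × E_{τ₂})(ℝ) = h(S¹)` ⟺ `E_{τ₁}` CM ∧ `E_{τ₁} ∼ E_{τ₂}` ⟺ `ρ(E_{τ₁} × E_{τ₂}) = 4`
  ⟺ `rk Hom(E_{τ₁}, E_{τ₂}) = 2`; `E_i × E_i` is on the locus (`ρ = 4`, p17 gen 1), while **`E_i × E_{i√2}` is NOT**
  although both factors are (`ℚ(i) ≠ ℚ(√-2)`: `Hom = 0`) — the locus of products is not the product of the loci.

## Proof route

§1 is g31-#4's `coe_hodgeGroup_eq_range_iff_finrank_endAlgRat_eq` at `Φ = prodPeriod Φ₁ Φ₂` (dimension `g₁ + g₂`)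
followed by the tree's `finrank_endAlgRat_prod_eq_two_mul_sq_iff` / `finrank_homRat_eq_two_mul_mul_iff` /
`finrank_neronSeveriGroup_prod_eq_sq_iff` (Beauville Prop. 3 + Lemma 1 for products).  §2 ⟸: `Xᵢ ∼ E_{τᵢ}^{gᵢ}` (g31-#4),
`rk Hom` is an isogeny invariant (`IsIsogenous.finrank_homRat_congr`) and a non-zero `Hom_ℚ(E_{τ₁}^{g₁}, E_{τ₂}^{g₂})` forces
`E_{τ₁} ∼ E_{τ₂}` (`isIsogenous_ellipticPeriod_of_finrank_homRat_pow_ne_zero`), so `X₂ ∼ E_{τ₁}^{g₂}` too.  §3: the product's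
Hodge circle is block-diagonal (`hodgeCircleSL_prodPeriod`) and `h(e^{iθ}) = 1` forces `e^{iθ} = 1` (`Φ(h(e^{iθ})x) = e^{iθ}Φ(x)`).
Deviation: Imai / Beauville argue with abelian varieties; everything here is at torus level (on the locus the tori ARE
abelian varieties, `isAbelianVariety_of_coe_hodgeGroup_eq_range`).

## References

* [Beauville2014MaximalPicard] A. Beauville, *Some surfaces with maximal Picard number*, J. Éc. polytech. Math. 1 (2014)
  101–116, §3 Prop. 3, §4 Prop. 5, Lemma 1. [cite: Beauville2014MaximalPicard, §4 Prop. 5 and Lemma 1 (p0006)]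
* [Imai1976HodgeGroups] H. Imai, Kōdai Math. Sem. Rep. 27 (1976) 367–372, p. 367, §2, §3 Remarks.
  [cite: Imai1976HodgeGroups, §3 Remarks (p. 370 L23–L38)]
* [GreenGriffithsKerr2012] M. Green, P. Griffiths, M. Kerr, *Mumford–Tate Groups and Domains* (2012), §III.B (i) (p. 72),
  §VII.G Prop. (VII.G.2) (ix). [cite: GreenGriffithsKerr2012, §III.B (i) (p. 72)]
* [Moonen1999MTNotes] B. Moonen, *Notes on Mumford–Tate groups* (1999), (1.13). [cite: Moonen1999MTNotes, (1.13)]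
* [MoonenZarhin1999LowDim] B. Moonen, Yu. Zarhin, Math. Ann. 315 (1999) 711–733, §1, (0.2)(4). [cite: MoonenZarhin1999LowDim, §1 (p0002)]
* [Lange2023AbelianVarietiesComplex] H. Lange, *Abelian Varieties over the Complex Numbers* (2023), §2.6.3 Exercise (2),
  §7.2.4 Exercise (3), §7.2.3 Prop. 7.2.6. [cite: Lange2023AbelianVarietiesComplex, §2.6.3 Exercise (2) (p0147)]
-/

noncomputable section

open scoped Matrix Real

open Set Function Module Matrix

namespace Literature.Geometry.Kaehler

namespace ComplexTorus

/-! ## §1 `Hg(X₁ × X₂)(ℝ) = h(S¹)` ⟺ `X₁ ∼ E^{g₁}`, `X₂ ∼ E^{g₂}` for one CM curve `E` -/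

section Products

variable {ι₁ ι₂ : Type*} [Fintype ι₁] [Fintype ι₂] [DecidableEq ι₁] [DecidableEq ι₂]
  {E₁ E₂ : Type*} [NormedAddCommGroup E₁] [NormedSpace ℂ E₁] [NormedAddCommGroup E₂] [NormedSpace ℂ E₂]
  [FiniteDimensional ℂ E₁] [FiniteDimensional ℂ E₂]
  (Φ₁ : (ι₁ → ℝ) ≃L[ℝ] E₁) (Φ₂ : (ι₂ → ℝ) ≃L[ℝ] E₂)

/-- **`Hg(X₁ × X₂)(ℝ) = h(S¹)` ⟺ `rk End(X₁ × X₂) = 2(g₁ + g₂)²`** (g31-#4 for the product torus, of dimension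
`g₁ + g₂ ≥ 1`). [cite: Beauville2014MaximalPicard, §3 Prop. 3 (ii)] [cite: Lange2023AbelianVarietiesComplex, §7.2.4 Exercise (3)] -/
theorem coe_hodgeGroup_prodPeriod_eq_range_iff_finrank_endAlgRat_eq (hg : 0 < finrank ℂ E₁ + finrank ℂ E₂) :
    (hodgeGroup (prodPeriod Φ₁ Φ₂) : Set (SpecialLinearGroup (ι₁ ⊕ ι₂) ℝ)) = Set.range (hodgeCircleSL (prodPeriod Φ₁ Φ₂)) ↔
      finrank ℚ (endAlgRat (prodPeriod Φ₁ Φ₂)) = 2 * (finrank ℂ E₁ + finrank ℂ E₂) ^ 2 := by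
  rw [coe_hodgeGroup_eq_range_iff_finrank_endAlgRat_eq (prodPeriod Φ₁ Φ₂) (by rw [Module.finrank_prod]; exact hg),
    Module.finrank_prod]

/-- **THE HODGE CIRCLE UNDER PRODUCTS: `Hg(X₁ × X₂)(ℝ) = h(S¹)` iff there is ONE elliptic curve `E_τ` with complex
multiplication such that `X₁ ∼ E_τ^{g₁}` and `X₂ ∼ E_τ^{g₂}`** (`g₁, g₂ ≥ 1`) — Beauville's Prop. 5 (ii) / Lemma 1 read on
the Hodge group: `X₁ × X₂ ∼ E_τ^{g₁+g₂}` means the SAME `E_τ` for both factors.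
[cite: Beauville2014MaximalPicard, §4 Prop. 5 and Lemma 1 (p0006)] [cite: GreenGriffithsKerr2012, §VII.G Prop. (VII.G.2) (ix)]
[cite: Imai1976HodgeGroups, §3 Remarks (p. 370)] -/
theorem coe_hodgeGroup_prodPeriod_eq_range_iff_exists_isIsogenous_ellipticPow_cm (hg₁ : 0 < finrank ℂ E₁)
    (hg₂ : 0 < finrank ℂ E₂) :
    (hodgeGroup (prodPeriod Φ₁ Φ₂) : Set (SpecialLinearGroup (ι₁ ⊕ ι₂) ℝ)) = Set.range (hodgeCircleSL (prodPeriod Φ₁ Φ₂)) ↔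
      ∃ τ : ℂ, ∃ hτ : τ.im ≠ 0, ellipticEnd hτ ≠ ⊥ ∧
        IsIsogenous Φ₁ (powPeriod (ellipticPeriod hτ) (finrank ℂ E₁)) ∧
          IsIsogenous Φ₂ (powPeriod (ellipticPeriod hτ) (finrank ℂ E₂)) := by
  rw [coe_hodgeGroup_prodPeriod_eq_range_iff_finrank_endAlgRat_eq Φ₁ Φ₂ (by omega)]
  exact finrank_endAlgRat_prod_eq_two_mul_sq_iff Φ₁ Φ₂ hg₁ hg₂

/-- **`Hg(X₁ × X₂)(ℝ) = h(S¹)` ⟺ `rk Hom(X₁, X₂) = 2g₁g₂`** (the equality case of Lemma 1).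
[cite: Beauville2014MaximalPicard, §4 Lemma 1 (p0006 L18–L19)] -/
theorem coe_hodgeGroup_prodPeriod_eq_range_iff_finrank_homRat_eq (hg₁ : 0 < finrank ℂ E₁) (hg₂ : 0 < finrank ℂ E₂) :
    (hodgeGroup (prodPeriod Φ₁ Φ₂) : Set (SpecialLinearGroup (ι₁ ⊕ ι₂) ℝ)) = Set.range (hodgeCircleSL (prodPeriod Φ₁ Φ₂)) ↔
      finrank ℚ (homRat Φ₁ Φ₂) = 2 * finrank ℂ E₁ * finrank ℂ E₂ := by
  rw [coe_hodgeGroup_prodPeriod_eq_range_iff_exists_isIsogenous_ellipticPow_cm Φ₁ Φ₂ hg₁ hg₂,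
    finrank_homRat_eq_two_mul_mul_iff Φ₁ Φ₂ hg₁ hg₂]

/-- **`Hg(X₁ × X₂)(ℝ) = h(S¹)` ⟺ `ρ(X₁ × X₂) = (g₁ + g₂)²`, for ALL `g₁, g₂ ≥ 1`** (the product has dimension `≥ 2`, so
Beauville's (i) ⟺ (ii) applies to it even when the factors are elliptic curves).
[cite: Beauville2014MaximalPicard, §3 Prop. 3 (i) ⟺ (iii) and §4 Prop. 5] [cite: Lange2023AbelianVarietiesComplex, §2.6.3 Exercise (2)] -/
theorem coe_hodgeGroup_prodPeriod_eq_range_iff_finrank_neronSeveriGroup_eq_sq (hg₁ : 0 < finrank ℂ E₁)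
    (hg₂ : 0 < finrank ℂ E₂) :
    (hodgeGroup (prodPeriod Φ₁ Φ₂) : Set (SpecialLinearGroup (ι₁ ⊕ ι₂) ℝ)) = Set.range (hodgeCircleSL (prodPeriod Φ₁ Φ₂)) ↔
      finrank ℤ (neronSeveriGroup (prodPeriod Φ₁ Φ₂)) = (finrank ℂ E₁ + finrank ℂ E₂) ^ 2 := by
  rw [coe_hodgeGroup_prodPeriod_eq_range_iff_exists_isIsogenous_ellipticPow_cm Φ₁ Φ₂ hg₁ hg₂,
    finrank_neronSeveriGroup_prod_eq_sq_iff Φ₁ Φ₂ hg₁ hg₂]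

/-- `Hg(X₁ × X₂)(ℝ) = h(S¹)` ⟹ `Hg(X₁)(ℝ) = h(S¹)` (the first factor is isogenous to a power of a CM curve).
[cite: Beauville2014MaximalPicard, §4 Lemma 1] [cite: MoonenZarhin1999LowDim, (0.2)(4)] -/
theorem coe_hodgeGroup_eq_range_of_prodPeriod_left (hg₁ : 0 < finrank ℂ E₁) (hg₂ : 0 < finrank ℂ E₂)
    (h : (hodgeGroup (prodPeriod Φ₁ Φ₂) : Set (SpecialLinearGroup (ι₁ ⊕ ι₂) ℝ)) =
      Set.range (hodgeCircleSL (prodPeriod Φ₁ Φ₂))) :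
    (hodgeGroup Φ₁ : Set (SpecialLinearGroup ι₁ ℝ)) = Set.range (hodgeCircleSL Φ₁) := by
  obtain ⟨τ, hτ, hcm, h₁, -⟩ :=
    (coe_hodgeGroup_prodPeriod_eq_range_iff_exists_isIsogenous_ellipticPow_cm Φ₁ Φ₂ hg₁ hg₂).1 h
  exact (coe_hodgeGroup_eq_range_iff_exists_isIsogenous_ellipticPow_cm Φ₁ hg₁).2 ⟨τ, hτ, hcm, h₁⟩

/-- `Hg(X₁ × X₂)(ℝ) = h(S¹)` ⟹ `Hg(X₂)(ℝ) = h(S¹)`. [cite: Beauville2014MaximalPicard, §4 Lemma 1] [cite: MoonenZarhin1999LowDim, (0.2)(4)] -/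
theorem coe_hodgeGroup_eq_range_of_prodPeriod_right (hg₁ : 0 < finrank ℂ E₁) (hg₂ : 0 < finrank ℂ E₂)
    (h : (hodgeGroup (prodPeriod Φ₁ Φ₂) : Set (SpecialLinearGroup (ι₁ ⊕ ι₂) ℝ)) =
      Set.range (hodgeCircleSL (prodPeriod Φ₁ Φ₂))) :
    (hodgeGroup Φ₂ : Set (SpecialLinearGroup ι₂ ℝ)) = Set.range (hodgeCircleSL Φ₂) := by
  obtain ⟨τ, hτ, hcm, -, h₂⟩ :=
    (coe_hodgeGroup_prodPeriod_eq_range_iff_exists_isIsogenous_ellipticPow_cm Φ₁ Φ₂ hg₁ hg₂).1 h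
  exact (coe_hodgeGroup_eq_range_iff_exists_isIsogenous_ellipticPow_cm Φ₂ hg₂).2 ⟨τ, hτ, hcm, h₂⟩

/-! ## §2 The criterion through the factors: both circles AND `Hom(X₁, X₂) ≠ 0` -/

/-- **`Hg(X₁ × X₂)(ℝ) = h(S¹)` ⟺ `Hg(X₁)(ℝ) = h(S¹)` ∧ `Hg(X₂)(ℝ) = h(S¹)` ∧ `Hom(X₁, X₂) ≠ 0`** (`g₁, g₂ ≥ 1`).
⟹: the factors (§1) and `rk Hom(X₁, X₂) = 2g₁g₂ > 0`; ⟸: `X₁ ∼ E_{τ₁}^{g₁}`, `X₂ ∼ E_{τ₂}^{g₂}` with CM curves (g31-#4), and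
a non-zero `Hom_ℚ(X₁, X₂) ≅ Hom_ℚ(E_{τ₁}^{g₁}, E_{τ₂}^{g₂}) = M_{g₂ × g₁}(Hom_ℚ(E_{τ₁}, E_{τ₂}))` forces `E_{τ₁} ∼ E_{τ₂}`
("`s = a₁ = 1`"), so `X₂ ∼ E_{τ₁}^{g₂}` as well. [cite: Beauville2014MaximalPicard, §4 Lemma 1 (proof, p0006)]
[cite: Imai1976HodgeGroups, p. 367 L9–L10 and §3 Remarks (p. 370)] -/
theorem coe_hodgeGroup_prodPeriod_eq_range_iff_homRat_ne_bot (hg₁ : 0 < finrank ℂ E₁) (hg₂ : 0 < finrank ℂ E₂) :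
    (hodgeGroup (prodPeriod Φ₁ Φ₂) : Set (SpecialLinearGroup (ι₁ ⊕ ι₂) ℝ)) = Set.range (hodgeCircleSL (prodPeriod Φ₁ Φ₂)) ↔
      (hodgeGroup Φ₁ : Set (SpecialLinearGroup ι₁ ℝ)) = Set.range (hodgeCircleSL Φ₁) ∧
        (hodgeGroup Φ₂ : Set (SpecialLinearGroup ι₂ ℝ)) = Set.range (hodgeCircleSL Φ₂) ∧ homRat Φ₁ Φ₂ ≠ ⊥ := by
  constructor
  · intro h
    refine ⟨coe_hodgeGroup_eq_range_of_prodPeriod_left Φ₁ Φ₂ hg₁ hg₂ h,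
      coe_hodgeGroup_eq_range_of_prodPeriod_right Φ₁ Φ₂ hg₁ hg₂ h, ?_⟩
    rw [Ne, ← Submodule.finrank_eq_zero, (coe_hodgeGroup_prodPeriod_eq_range_iff_finrank_homRat_eq Φ₁ Φ₂ hg₁ hg₂).1 h]
    positivity
  · rintro ⟨h₁, h₂, hne⟩
    obtain ⟨τ₁, hτ₁, hcm₁, hX₁⟩ := (coe_hodgeGroup_eq_range_iff_exists_isIsogenous_ellipticPow_cm Φ₁ hg₁).1 h₁
    obtain ⟨τ₂, hτ₂, -, hX₂⟩ := (coe_hodgeGroup_eq_range_iff_exists_isIsogenous_ellipticPow_cm Φ₂ hg₂).1 h₂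
    have hne' : finrank ℚ (homRat (powPeriod (ellipticPeriod hτ₁) (finrank ℂ E₁))
        (powPeriod (ellipticPeriod hτ₂) (finrank ℂ E₂))) ≠ 0 := by
      rw [← hX₁.finrank_homRat_congr hX₂, Ne, Submodule.finrank_eq_zero]
      exact hne
    have hE : IsIsogenous (ellipticPeriod hτ₂) (ellipticPeriod hτ₁) :=
      (isIsogenous_ellipticPeriod_of_finrank_homRat_pow_ne_zero hτ₁ hτ₂ hne').symm _ _
    exact (coe_hodgeGroup_prodPeriod_eq_range_iff_exists_isIsogenous_ellipticPow_cm Φ₁ Φ₂ hg₁ hg₂).2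
      ⟨τ₁, hτ₁, hcm₁, hX₁, hX₂.trans _ _ _ (hE.pow _ _ _)⟩

/-- **`Hg(X₁ × X₂)(ℝ) = h(S¹)` ⟺ `Hg(X₁)(ℝ) = h(S¹)` ∧ `Hg(X₂)(ℝ) = h(S¹)` ∧ `X₁^{g₂} ∼ X₂^{g₁}`** — both factors on the
locus with isogenous powers of the common dimension `g₁g₂`.
[cite: Beauville2014MaximalPicard, §4 Lemma 1 and §3 Prop. 3] [cite: MoonenZarhin1999LowDim, (0.2)(4) and §1] -/
theorem coe_hodgeGroup_prodPeriod_eq_range_iff_isIsogenous_pow (hg₁ : 0 < finrank ℂ E₁) (hg₂ : 0 < finrank ℂ E₂) :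
    (hodgeGroup (prodPeriod Φ₁ Φ₂) : Set (SpecialLinearGroup (ι₁ ⊕ ι₂) ℝ)) = Set.range (hodgeCircleSL (prodPeriod Φ₁ Φ₂)) ↔
      (hodgeGroup Φ₁ : Set (SpecialLinearGroup ι₁ ℝ)) = Set.range (hodgeCircleSL Φ₁) ∧
        (hodgeGroup Φ₂ : Set (SpecialLinearGroup ι₂ ℝ)) = Set.range (hodgeCircleSL Φ₂) ∧
          IsIsogenous (powPeriod Φ₁ (finrank ℂ E₂)) (powPeriod Φ₂ (finrank ℂ E₁)) := by
  rw [coe_hodgeGroup_prodPeriod_eq_range_iff_finrank_homRat_eq Φ₁ Φ₂ hg₁ hg₂,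
    finrank_homRat_eq_two_mul_mul_iff_finrank_endAlgRat_eq Φ₁ Φ₂ hg₁ hg₂,
    coe_hodgeGroup_eq_range_iff_finrank_endAlgRat_eq Φ₁ hg₁, coe_hodgeGroup_eq_range_iff_finrank_endAlgRat_eq Φ₂ hg₂]

/-- **EQUAL DIMENSIONS `g₁ = g₂`: `Hg(X₁ × X₂)(ℝ) = h(S¹)` ⟺ `Hg(X₁)(ℝ) = h(S¹)` ∧ `X₁ ∼ X₂`** (Lemma 1 for `a = b`:
`rk Hom(X₁, X₂) = 2g²` ⟺ `X₁ ∼ X₂` with `rk End(X₁) = 2g²`). [cite: Beauville2014MaximalPicard, §4 Lemma 1 (equality case, `a = b`)]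
[cite: Imai1976HodgeGroups, §3 Remarks (p. 370 L23–L25)] -/
theorem coe_hodgeGroup_prodPeriod_eq_range_iff_isIsogenous_of_finrank_eq (hg₁ : 0 < finrank ℂ E₁)
    (h12 : finrank ℂ E₁ = finrank ℂ E₂) :
    (hodgeGroup (prodPeriod Φ₁ Φ₂) : Set (SpecialLinearGroup (ι₁ ⊕ ι₂) ℝ)) = Set.range (hodgeCircleSL (prodPeriod Φ₁ Φ₂)) ↔
      (hodgeGroup Φ₁ : Set (SpecialLinearGroup ι₁ ℝ)) = Set.range (hodgeCircleSL Φ₁) ∧ IsIsogenous Φ₁ Φ₂ := by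
  rw [coe_hodgeGroup_prodPeriod_eq_range_iff_finrank_homRat_eq Φ₁ Φ₂ hg₁ (h12 ▸ hg₁), ← h12, mul_assoc, ← sq,
    finrank_homRat_eq_two_mul_sq_iff Φ₁ Φ₂ h12, coe_hodgeGroup_eq_range_iff_finrank_endAlgRat_eq Φ₁ hg₁, and_comm]

/-- **SYMMETRY IN THE FACTORS**: `Hg(X₁ × X₂)(ℝ) = h(S¹)` ⟺ `Hg(X₂ × X₁)(ℝ) = h(S¹)`.
[cite: Beauville2014MaximalPicard, §4 Prop. 5] -/
theorem coe_hodgeGroup_prodPeriod_eq_range_comm (hg₁ : 0 < finrank ℂ E₁) (hg₂ : 0 < finrank ℂ E₂) :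
    (hodgeGroup (prodPeriod Φ₁ Φ₂) : Set (SpecialLinearGroup (ι₁ ⊕ ι₂) ℝ)) = Set.range (hodgeCircleSL (prodPeriod Φ₁ Φ₂)) ↔
      (hodgeGroup (prodPeriod Φ₂ Φ₁) : Set (SpecialLinearGroup (ι₂ ⊕ ι₁) ℝ)) = Set.range (hodgeCircleSL (prodPeriod Φ₂ Φ₁)) := by
  rw [coe_hodgeGroup_prodPeriod_eq_range_iff_exists_isIsogenous_ellipticPow_cm Φ₁ Φ₂ hg₁ hg₂,
    coe_hodgeGroup_prodPeriod_eq_range_iff_exists_isIsogenous_ellipticPow_cm Φ₂ Φ₁ hg₂ hg₁]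
  exact ⟨fun ⟨τ, hτ, hcm, h₁, h₂⟩ ↦ ⟨τ, hτ, hcm, h₂, h₁⟩, fun ⟨τ, hτ, hcm, h₂, h₁⟩ ↦ ⟨τ, hτ, hcm, h₁, h₂⟩⟩

end Products

/-! ### The self-product `X × X` -/

section SelfProduct

variable {ι : Type*} [Fintype ι] [DecidableEq ι] {E : Type*} [NormedAddCommGroup E] [NormedSpace ℂ E]
  [FiniteDimensional ℂ E] (Φ : (ι → ℝ) ≃L[ℝ] E)

/-- **`Hg(X × X)(ℝ) = h(S¹)` ⟺ `Hg(X)(ℝ) = h(S¹)`** (`g ≥ 1`; "identify `Hg(Xⁿ)` with `Hg(X)`", here on the carrier `X × X`).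
[cite: MoonenZarhin1999LowDim, §1 and (0.2)(4)] [cite: Beauville2014MaximalPicard, §4 Prop. 6 (i) ⟺ (ii)] -/
theorem coe_hodgeGroup_prodPeriod_self_eq_range_iff (hg : 0 < finrank ℂ E) :
    (hodgeGroup (prodPeriod Φ Φ) : Set (SpecialLinearGroup (ι ⊕ ι) ℝ)) = Set.range (hodgeCircleSL (prodPeriod Φ Φ)) ↔
      (hodgeGroup Φ : Set (SpecialLinearGroup ι ℝ)) = Set.range (hodgeCircleSL Φ) := by
  rw [coe_hodgeGroup_prodPeriod_eq_range_iff_isIsogenous_of_finrank_eq Φ Φ hg rfl]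
  exact ⟨fun h ↦ h.1, fun h ↦ ⟨h, IsIsogenous.refl Φ⟩⟩

/-- … equivalently `ρ(X × X) = (2g)²` ⟺ `Hg(X)(ℝ) = h(S¹)` (every `g ≥ 1`). [cite: Beauville2014MaximalPicard, §4 Prop. 6 and §3 Prop. 3] -/
theorem finrank_neronSeveriGroup_prodPeriod_self_eq_sq_iff_coe_hodgeGroup_eq_range (hg : 0 < finrank ℂ E) :
    finrank ℤ (neronSeveriGroup (prodPeriod Φ Φ)) = (finrank ℂ E + finrank ℂ E) ^ 2 ↔
      (hodgeGroup Φ : Set (SpecialLinearGroup ι ℝ)) = Set.range (hodgeCircleSL Φ) := by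
  rw [← coe_hodgeGroup_prodPeriod_eq_range_iff_finrank_neronSeveriGroup_eq_sq Φ Φ hg hg,
    coe_hodgeGroup_prodPeriod_self_eq_range_iff Φ hg]

end SelfProduct

/-! ## §3 On the locus `Hg(X₁ × X₂)` is the diagonal circle, strictly inside `Hg(X₁) × Hg(X₂)`; consequences -/

section Diagonal

variable {ι : Type*} [Fintype ι] [DecidableEq ι] {E : Type*} [NormedAddCommGroup E] [NormedSpace ℂ E]
  (Φ : (ι → ℝ) ≃L[ℝ] E)

/-- **`h(e^{iθ}) = 1` iff `e^{iθ} = 1`** (for a non-zero lattice: `h(e^{iθ})` acts on `V = E` as multiplication by `e^{iθ}`).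
[cite: Lange2023AbelianVarietiesComplex, §7.1.1 Prop. 7.1.1] -/
theorem hodgeCircle_eq_one_iff [Nonempty ι] (θ : ℝ) :
    hodgeCircle Φ θ = 1 ↔ Complex.exp (θ * Complex.I) = 1 := by
  refine ⟨fun h ↦ ?_, fun h ↦ by rw [← hodgeS_exp_mul_I, h, hodgeS_one]⟩
  obtain ⟨i⟩ := ‹Nonempty ι›
  have hx : Φ (Pi.single i 1) ≠ 0 := fun h0 ↦ by
    have := congr_fun (Φ.injective (h0.trans (map_zero Φ).symm)) i
    simp at this
  have h1 := apply_hodgeCircle_mulVec Φ θ (Pi.single i 1)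
  rw [h, Matrix.one_mulVec] at h1
  have h2 : (Complex.exp (θ * Complex.I) - 1) • Φ (Pi.single i 1) = 0 := by
    rw [sub_smul, one_smul, ← h1, sub_self]
  exact sub_eq_zero.1 ((smul_eq_zero.1 h2).resolve_right hx)

variable {ι₁ ι₂ : Type*} [Fintype ι₁] [Fintype ι₂] [DecidableEq ι₁] [DecidableEq ι₂]
  {E₁ E₂ : Type*} [NormedAddCommGroup E₁] [NormedSpace ℂ E₁] [NormedAddCommGroup E₂] [NormedSpace ℂ E₂]
  (Φ₁ : (ι₁ → ℝ) ≃L[ℝ] E₁) (Φ₂ : (ι₂ → ℝ) ≃L[ℝ] E₂)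

/-- **ON THE LOCUS `Hg(X₁ × X₂)(ℝ) = {(h₁(e^{iθ}) 0; 0 h₂(e^{iθ}))}` IS THE DIAGONAL CIRCLE** inside
`Hg(X₁)(ℝ) × Hg(X₂)(ℝ) = h₁(S¹) × h₂(S¹)` (Imai: `Δ` "the diagonal subgroup"; `{(x, λxλ⁻¹)}`).
[cite: Imai1976HodgeGroups, §3 Remarks (p. 370 L23–L38)] [cite: GreenGriffithsKerr2012, §III.B (i) (p. 72)] -/
theorem coe_hodgeGroup_prodPeriod_eq_range_blockDiag
    (h : (hodgeGroup (prodPeriod Φ₁ Φ₂) : Set (SpecialLinearGroup (ι₁ ⊕ ι₂) ℝ)) =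
      Set.range (hodgeCircleSL (prodPeriod Φ₁ Φ₂))) :
    (hodgeGroup (prodPeriod Φ₁ Φ₂) : Set (SpecialLinearGroup (ι₁ ⊕ ι₂) ℝ)) =
      Set.range (fun θ : ℝ ↦ blockDiag ι₁ ι₂ (hodgeCircleSL Φ₁ θ, hodgeCircleSL Φ₂ θ)) := by
  rw [h]
  exact congrArg Set.range (funext (hodgeCircleSL_prodPeriod Φ₁ Φ₂))

/-- **STRICTNESS `Hg(X₁ × X₂) ⊊ Hg(X₁) × Hg(X₂)` ON THE LOCUS** (`V₁, V₂ ≠ 0`): the element `(h₁(1) 0; 0 h₂(e^{iπ})) =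
(1 0; 0 -1)` of `Hg(X₁)(ℝ) × Hg(X₂)(ℝ)` is not of the form `(h₁(e^{iθ}) 0; 0 h₂(e^{iθ}))` — "the inclusions … are in
general not isomorphisms", "this need not be an equality". [cite: GreenGriffithsKerr2012, §III.B (i) (p. 72)]
[cite: Moonen1999MTNotes, (1.13)] [cite: Imai1976HodgeGroups, §3 Remarks (p. 370)] -/
theorem hodgeGroup_prodPeriod_lt_of_coe_eq_range [Nonempty ι₁] [Nonempty ι₂]
    (h : (hodgeGroup (prodPeriod Φ₁ Φ₂) : Set (SpecialLinearGroup (ι₁ ⊕ ι₂) ℝ)) =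
      Set.range (hodgeCircleSL (prodPeriod Φ₁ Φ₂))) :
    hodgeGroup (prodPeriod Φ₁ Φ₂) < ((hodgeGroup Φ₁).prod (hodgeGroup Φ₂)).map (blockDiag ι₁ ι₂) := by
  refine lt_of_le_of_ne (hodgeGroup_prod_le Φ₁ Φ₂) fun heq ↦ ?_
  have hmem : blockDiag ι₁ ι₂ (hodgeCircleSL Φ₁ 0, hodgeCircleSL Φ₂ π) ∈
      ((hodgeGroup Φ₁).prod (hodgeGroup Φ₂)).map (blockDiag ι₁ ι₂) :=
    Subgroup.mem_map_of_mem _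
      (Subgroup.mem_prod.2 ⟨hodgeCircleSL_mem_hodgeGroup Φ₁ 0, hodgeCircleSL_mem_hodgeGroup Φ₂ π⟩)
  rw [← heq, ← SetLike.mem_coe, h] at hmem
  obtain ⟨θ, hθ⟩ := hmem
  rw [hodgeCircleSL_prodPeriod] at hθ
  have hθ' := blockDiag_injective ι₁ ι₂ hθ
  have h1 : hodgeCircle Φ₁ θ = 1 := by
    have := congrArg (fun p : SpecialLinearGroup ι₁ ℝ × SpecialLinearGroup ι₂ ℝ ↦ (p.1 : Matrix ι₁ ι₁ ℝ)) hθ'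
    simpa using this
  have h2 : hodgeCircle Φ₂ θ = -1 := by
    have := congrArg (fun p : SpecialLinearGroup ι₁ ℝ × SpecialLinearGroup ι₂ ℝ ↦ (p.2 : Matrix ι₂ ι₂ ℝ)) hθ'
    simpa [hodgeCircle_pi] using this
  rw [hodgeCircle_eq_one_iff] at h1
  rw [← hodgeS_exp_mul_I, h1, hodgeS_one] at h2
  obtain ⟨j⟩ := ‹Nonempty ι₂›
  have h3 := congr_fun (congr_fun h2 j) j
  norm_num at h3

/-- Hence on the locus `Hg(X₁ × X₂)(ℝ) ≠ Hg(X₁)(ℝ) × Hg(X₂)(ℝ)`: the hypothesis "`Hg(X₁ × X₂) = Hg(X₁) × Hg(X₂)`" of the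
product formulas (Moonen–Zarhin §3, the lane's `SiegelFamilyProductLociMumfordTateGroupMultiplier`) FAILS there.
[cite: Moonen1999MTNotes, (1.13)] [cite: GreenGriffithsKerr2012, §III.B (i) (p. 72)] -/
theorem hodgeGroup_prodPeriod_ne_map_blockDiag_prod [Nonempty ι₁] [Nonempty ι₂]
    (h : (hodgeGroup (prodPeriod Φ₁ Φ₂) : Set (SpecialLinearGroup (ι₁ ⊕ ι₂) ℝ)) =
      Set.range (hodgeCircleSL (prodPeriod Φ₁ Φ₂))) :
    hodgeGroup (prodPeriod Φ₁ Φ₂) ≠ ((hodgeGroup Φ₁).prod (hodgeGroup Φ₂)).map (blockDiag ι₁ ι₂) :=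
  (hodgeGroup_prodPeriod_lt_of_coe_eq_range Φ₁ Φ₂ h).ne

variable [FiniteDimensional ℂ E₁] [FiniteDimensional ℂ E₂]

/-- **ON THE LOCUS `X₁ × X₂` IS AN ABELIAN VARIETY** (maximal Picard number). [cite: Beauville2014MaximalPicard, §3 Prop. 3 and §4 Prop. 5] -/
theorem isAbelianVariety_prodPeriod_of_coe_hodgeGroup_eq_range (hg : 0 < finrank ℂ E₁ + finrank ℂ E₂)
    (h : (hodgeGroup (prodPeriod Φ₁ Φ₂) : Set (SpecialLinearGroup (ι₁ ⊕ ι₂) ℝ)) =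
      Set.range (hodgeCircleSL (prodPeriod Φ₁ Φ₂))) :
    IsAbelianVariety (prodPeriod Φ₁ Φ₂) :=
  isAbelianVariety_of_coe_hodgeGroup_eq_range (by rw [Module.finrank_prod]; exact hg) h

/-- **ON THE LOCUS EVERY HODGE CLASS OF `X₁ × X₂` IS A DIVISOR POLYNOMIAL: `H^{2p}_Hodge(X₁ × X₂) = D^p(X₁ × X₂)`, of
dimension `C(g₁ + g₂, p)²`** (`g₁, g₂ ≥ 1`, so `dim (X₁ × X₂) ≥ 2`; Lange's Exercise 7.3.3 (3)(a) for `X₁ × X₂ ∼ E_τ^{g₁+g₂}`).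
[cite: Lange2023AbelianVarietiesComplex, §7.3.3 Exercise (3)(a),(b) (p. 342)] [cite: Beauville2014MaximalPicard, §4 Prop. 5] -/
theorem divisorClasses_prodPeriod_eq_hodgeClasses_of_coe_hodgeGroup_eq_range (hg₁ : 0 < finrank ℂ E₁)
    (hg₂ : 0 < finrank ℂ E₂)
    (h : (hodgeGroup (prodPeriod Φ₁ Φ₂) : Set (SpecialLinearGroup (ι₁ ⊕ ι₂) ℝ)) =
      Set.range (hodgeCircleSL (prodPeriod Φ₁ Φ₂))) (p : ℕ) :
    divisorClasses (prodPeriod Φ₁ Φ₂) p = hodgeClasses (prodPeriod Φ₁ Φ₂) p ∧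
      finrank ℚ (hodgeClasses (prodPeriod Φ₁ Φ₂) p) = ((finrank ℂ E₁ + finrank ℂ E₂).choose p) ^ 2 := by
  have h2 : 2 ≤ finrank ℂ (E₁ × E₂) := by rw [Module.finrank_prod]; omega
  have := divisorClasses_eq_hodgeClasses_of_coe_hodgeGroup_eq_range h2 h p
  rwa [Module.finrank_prod] at this

/-- **ON THE LOCUS `Lf(X₁ × X₂) = Hg(X₁ × X₂)` (`= U(1)`) for every polarisation of `X₁ × X₂`.**
[cite: Gordon1997, 7.5 Theorem (b)] [cite: Lange2023AbelianVarietiesComplex, §7.2.4 Exercises (4), (5)] -/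
theorem IsRiemannForm.lefschetzGroup_prodPeriod_eq_hodgeGroup_of_coe_hodgeGroup_eq_range
    (hg : 0 < finrank ℂ E₁ + finrank ℂ E₂)
    (h : (hodgeGroup (prodPeriod Φ₁ Φ₂) : Set (SpecialLinearGroup (ι₁ ⊕ ι₂) ℝ)) =
      Set.range (hodgeCircleSL (prodPeriod Φ₁ Φ₂))) {η : (E₁ × E₂) [⋀^Fin 2]→L[ℝ] ℝ}
    (hη : IsRiemannForm (prodPeriod Φ₁ Φ₂) η) :
    lefschetzGroup (prodPeriod Φ₁ Φ₂) η = hodgeGroup (prodPeriod Φ₁ Φ₂) :=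
  hη.lefschetzGroup_eq_hodgeGroup_of_coe_hodgeGroup_eq_range (by rw [Module.finrank_prod]; exact hg) h

end Diagonal

/-! ## §4 Products of two elliptic curves; `E_i × E_i` versus `E_i × E_{i√2}` -/

section Elliptic

variable {τ₁ τ₂ : ℂ} (hτ₁ : τ₁.im ≠ 0) (hτ₂ : τ₂.im ≠ 0)

include hτ₁ hτ₂ in
/-- **`Hg(E_{τ₁} × E_{τ₂})(ℝ) = h(S¹)` ⟺ `E_{τ₁}` HAS COMPLEX MULTIPLICATION AND `E_{τ₁} ∼ E_{τ₂}`** (Imai: for isogenous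
curves the Hodge group of `E₁ × E₂` is `{(x, λxλ⁻¹)} ≅ Hg(E₁)`, a 1-dimensional torus iff CM; for non-isogenous curves it is
`Hg(E₁) × Hg(E₂)`, of dimension `≥ 2`). [cite: Imai1976HodgeGroups, p. 367 L9–L10, §2 (p. 368 L5–L7) and §3 Remarks (p. 370)]
[cite: Beauville2014MaximalPicard, §4 Lemma 1 (`a = b = 1`)] -/
theorem coe_hodgeGroup_prodPeriod_ellipticPeriod_eq_range_iff :
    (hodgeGroup (prodPeriod (ellipticPeriod hτ₁) (ellipticPeriod hτ₂)) : Set (SpecialLinearGroup (Fin 2 ⊕ Fin 2) ℝ)) =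
        Set.range (hodgeCircleSL (prodPeriod (ellipticPeriod hτ₁) (ellipticPeriod hτ₂))) ↔
      ellipticEnd hτ₁ ≠ ⊥ ∧ IsIsogenous (ellipticPeriod hτ₁) (ellipticPeriod hτ₂) := by
  rw [coe_hodgeGroup_prodPeriod_eq_range_iff_isIsogenous_of_finrank_eq _ _
      (by rw [Module.finrank_self]; exact one_pos) rfl,
    coe_hodgeGroup_ellipticPeriod_eq_range_iff_ne_bot hτ₁]

include hτ₁ hτ₂ in
/-- **… ⟺ `ρ(E_{τ₁} × E_{τ₂}) = 4`** (the product surface has maximal Picard number).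
[cite: Beauville2014MaximalPicard, §4 Prop. 5 (`g = g' = 1`) and §3 Prop. 3] [cite: Lange2023AbelianVarietiesComplex, §2.6.3 Exercise (2) (iv)] -/
theorem coe_hodgeGroup_prodPeriod_ellipticPeriod_eq_range_iff_finrank_neronSeveriGroup_eq_four :
    (hodgeGroup (prodPeriod (ellipticPeriod hτ₁) (ellipticPeriod hτ₂)) : Set (SpecialLinearGroup (Fin 2 ⊕ Fin 2) ℝ)) =
        Set.range (hodgeCircleSL (prodPeriod (ellipticPeriod hτ₁) (ellipticPeriod hτ₂))) ↔
      finrank ℤ (neronSeveriGroup (prodPeriod (ellipticPeriod hτ₁) (ellipticPeriod hτ₂))) = 4 := by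
  rw [coe_hodgeGroup_prodPeriod_eq_range_iff_finrank_neronSeveriGroup_eq_sq _ _
      (by rw [Module.finrank_self]; exact one_pos) (by rw [Module.finrank_self]; exact one_pos), Module.finrank_self]
  norm_num

include hτ₁ hτ₂ in
/-- **… ⟺ `rk Hom(E_{τ₁}, E_{τ₂}) = 2`.** [cite: Beauville2014MaximalPicard, §4 Lemma 1 (`a = b = 1`)] -/
theorem coe_hodgeGroup_prodPeriod_ellipticPeriod_eq_range_iff_finrank_homRat_eq_two :
    (hodgeGroup (prodPeriod (ellipticPeriod hτ₁) (ellipticPeriod hτ₂)) : Set (SpecialLinearGroup (Fin 2 ⊕ Fin 2) ℝ)) =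
        Set.range (hodgeCircleSL (prodPeriod (ellipticPeriod hτ₁) (ellipticPeriod hτ₂))) ↔
      finrank ℚ (homRat (ellipticPeriod hτ₁) (ellipticPeriod hτ₂)) = 2 := by
  rw [coe_hodgeGroup_prodPeriod_eq_range_iff_finrank_homRat_eq _ _
      (by rw [Module.finrank_self]; exact one_pos) (by rw [Module.finrank_self]; exact one_pos), Module.finrank_self]

/-- **`E_i × E_i` IS ON THE LOCUS: `Hg(E_i × E_i)(ℝ) = h(S¹)`** (and `ρ(E_i × E_i) = 4`, p17 gen 1's
`finrank_hodgeClasses_gaussianSquare` on the same carrier). [cite: Lange2023AbelianVarietiesComplex, §2.6.3 Exercise (2) and §5.1.5 Exercise (3) (table: `Y = 1₂ ↦ ρ = 4`)]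
[cite: Imai1976HodgeGroups, §3 Remarks (p. 370)] -/
theorem coe_hodgeGroup_prodPeriod_gaussian_eq_range (hI : Complex.I.im ≠ 0) :
    (hodgeGroup (prodPeriod (ellipticPeriod hI) (ellipticPeriod hI)) : Set (SpecialLinearGroup (Fin 2 ⊕ Fin 2) ℝ)) =
      Set.range (hodgeCircleSL (prodPeriod (ellipticPeriod hI) (ellipticPeriod hI))) :=
  (coe_hodgeGroup_prodPeriod_ellipticPeriod_eq_range_iff hI hI).2 ⟨ellipticEnd_gaussian_ne_bot hI, IsIsogenous.refl _⟩

/-- `E_{i√2}` has complex multiplication (`(i√2)² + 2 = 0`), so `Hg(E_{i√2})(ℝ) = h(S¹)`.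
[cite: Imai1976HodgeGroups, §2 (p. 368 L5–L7)] [cite: Lange2023AbelianVarietiesComplex, §2.6.3 Exercise (2)] -/
theorem coe_hodgeGroup_ellipticPeriod_I_mul_sqrt_two_eq_range (h : (Complex.I * Real.sqrt 2).im ≠ 0) :
    (hodgeGroup (ellipticPeriod h) : Set (SpecialLinearGroup (Fin 2) ℝ)) = Set.range (hodgeCircleSL (ellipticPeriod h)) := by
  refine (coe_hodgeGroup_ellipticPeriod_eq_range_iff_ne_bot h).2 ((ellipticEnd_ne_bot_iff h).2 ⟨0, 2, ?_⟩)
  have h2 : ((Real.sqrt 2 : ℝ) : ℂ) ^ 2 = 2 := by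
    rw [← Complex.ofReal_pow, Real.sq_sqrt (by norm_num : (0 : ℝ) ≤ 2)]
    norm_num
  rw [mul_pow, Complex.I_sq, h2]
  push_cast
  ring

/-- **`E_i × E_{i√2}` IS NOT ON THE LOCUS although both factors are**: `ℚ(i) ≠ ℚ(√-2)`, `E_i ≁ E_{i√2}`, `Hom(E_i, E_{i√2}) = 0`,
and `Hg(E_i × E_{i√2}) = Hg(E_i) × Hg(E_{i√2})` is a 2-dimensional torus — the Hodge-circle locus of products is NOT the
product of the loci. [cite: Imai1976HodgeGroups, p. 367 L9–L10 (non-isogenous curves) and §2] [cite: Beauville2014MaximalPicard, §4 Lemma 1] -/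
theorem coe_hodgeGroup_prodPeriod_I_I_mul_sqrt_two_ne_range (hI : Complex.I.im ≠ 0) (h : (Complex.I * Real.sqrt 2).im ≠ 0) :
    (hodgeGroup (ellipticPeriod hI) : Set (SpecialLinearGroup (Fin 2) ℝ)) = Set.range (hodgeCircleSL (ellipticPeriod hI)) ∧
      (hodgeGroup (ellipticPeriod h) : Set (SpecialLinearGroup (Fin 2) ℝ)) = Set.range (hodgeCircleSL (ellipticPeriod h)) ∧
        homRat (ellipticPeriod hI) (ellipticPeriod h) = ⊥ ∧
          (hodgeGroup (prodPeriod (ellipticPeriod hI) (ellipticPeriod h)) : Set (SpecialLinearGroup (Fin 2 ⊕ Fin 2) ℝ)) ≠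
            Set.range (hodgeCircleSL (prodPeriod (ellipticPeriod hI) (ellipticPeriod h))) := by
  have hni : ¬ IsIsogenous (ellipticPeriod hI) (ellipticPeriod h) := not_isIsogenous_ellipticPeriod_I_I_sqrt_two
  have hbot : homRat (ellipticPeriod hI) (ellipticPeriod h) = ⊥ :=
    (isSimple_of_card_eq_two _ (Fintype.card_fin 2)).homRat_eq_bot (isSimple_of_card_eq_two _ (Fintype.card_fin 2)) hni
  refine ⟨(coe_hodgeGroup_ellipticPeriod_eq_range_iff_ne_bot hI).2 (ellipticEnd_gaussian_ne_bot hI),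
    coe_hodgeGroup_ellipticPeriod_I_mul_sqrt_two_eq_range h, hbot, fun hc ↦ ?_⟩
  exact ((coe_hodgeGroup_prodPeriod_eq_range_iff_homRat_ne_bot _ _ (by rw [Module.finrank_self]; exact one_pos)
    (by rw [Module.finrank_self]; exact one_pos)).1 hc).2.2 hbot

/-- … and accordingly `ρ(E_i × E_{i√2}) ≠ 4`. [cite: Beauville2014MaximalPicard, §4 Prop. 5 (`g = g' = 1`)] -/
theorem finrank_neronSeveriGroup_prodPeriod_I_I_mul_sqrt_two_ne_four (hI : Complex.I.im ≠ 0)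
    (h : (Complex.I * Real.sqrt 2).im ≠ 0) :
    finrank ℤ (neronSeveriGroup (prodPeriod (ellipticPeriod hI) (ellipticPeriod h))) ≠ 4 := by
  rw [Ne, ← coe_hodgeGroup_prodPeriod_ellipticPeriod_eq_range_iff_finrank_neronSeveriGroup_eq_four hI h]
  exact (coe_hodgeGroup_prodPeriod_I_I_mul_sqrt_two_ne_range hI h).2.2.2

end Elliptic

end ComplexTorus

end Literature.Geometry.Kaehler
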